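import Mathlib
import Literature.LinearAlgebra.Matrix.PosSemidefTrace
import Summits.HubbardSuperconductivity.HubbardSuperconductivity.Theorems.BalabanIRBirBdGPhaseCoercivityTraceNorm

/-!
# Route BalabanIR — crux 3 `BirBdGPhaseCoercivity` (item `stmt-HubbardSuperconductivity-2081`):
# the Lyapunov (BCS-duality) deficit bound — abstract matrix lemmas (Bach's inequality etc.)

This file supplies the lemmas; the theorem `lyap_deficit` they serve is assembled in the file
`…Lyapunov`. For a Bogoliubov–de Gennes matrix `X = [[h, D], [Dᴴ, -h]]` write `S(D) = Σ_i |λ_i(X)|`. Let the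
REFERENCE pairing `C` commute with `h`, be normal, and let `E ≻ 0` with `E² = h² + C Cᴴ`
commute with `h` and `C` (so `E ⊕ E = |[[h, C], [Cᴴ, -h]]|`). THEOREM (`lyap_deficit`): for
EVERY pairing block `D` and every real `Φ` with
  `0 ≤ 2 Re Tr (Dᴴ α) + Re Tr (αᴴ (E α + α E)) + Φ` for all `α`
(i.e. `Φ ≥ ⟨D, 𝓛_E⁻¹ D⟩` for the Lyapunov operator `𝓛_E(α) = E α + α E`),
  `S(C) - S(D) ≥ Re Tr (E⁻¹ Cᴴ C) - 2 Φ`.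
With the optimal `Φ = ⟨D, 𝓛_E⁻¹ D⟩` this is the tangent bound `S(D) ≤ S(C) - 2⟨C, 𝓛_E⁻¹ C⟩ +
2⟨D, 𝓛_E⁻¹ D⟩` of the quasi-free energy by the Legendre transform of the BCS functional
`𝓕(Γ) = Tr (H₀₀ Γ) - ⟨α_Γ, 𝓛_E α_Γ⟩` (`0 ≤ Γ ≤ 1`), whose GLOBAL minimiser is the BdG ground state
`P = ½ (1 - X₀ (E ⊕ E)⁻¹)` of the reference: the gap equation `𝓛_E(α_P) = -C` holds identically
and the stability form vanishes identically, because BACH's inequality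
`Tr (X₀ (Γ - P)) ≥ Tr (|X₀| (Γ - P)²)` (`lyap_bach`) and the block estimate
`Tr ((E ⊕ E) Y²) ≥ ⟨β, 𝓛_E β⟩` (`lyap_block_trace_ge`, `β` = pairing block of `Y`) give
`𝓕(Γ) - 𝓕(P) ≥ 0` with no condition. The infimum over `Γ` of `Tr (X Γ)` is `-½ S(D)` (negative
spectral projection, `lyap_exists_negProj`; `Tr X = 0`).

References: V. Bach, E. H. Lieb, J. P. Solovej, J. Stat. Phys. 76 (1994) 3 (generalised
Hartree–Fock states, the inequality `Tr H(Γ - P) ≥ Tr |H|(Γ - P)²`); C. Hainzl, R. Seiringer,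
J. Math. Phys. 57 (2016) 021101, §2 (BCS functional, Birman–Schwinger / relative-entropy
form of the second variation); A. Deuchert, A. Geisinger, C. Hainzl, M. Loss, Ann. Henri
Poincaré 19 (2018) 1507, Lemma 4.1 (the identity `𝓕(Γ) - 𝓕(Γ₀) = Tr H₀(Γ - Γ₀) - ⟨δα, V δα⟩`).
No definition is introduced.
-/

noncomputable section

open scoped ComplexOrder

namespace Summit.HubbardSuperconductivity.HubbardSuperconductivity.Theorems

namespace BirBdG

open Matrix

variable {n : Type*} [Fintype n] [DecidableEq n]

/-! ### Positivity lemmas -/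

/-- `Γ - Γ² ⪰ 0` for `0 ≤ Γ ≤ 1`: `Γ - Γ² = Γ (1 - Γ) Γ + (1 - Γ) Γ (1 - Γ)`. [folklore] -/
theorem lyap_sub_sq_posSemidef {Γ : Matrix n n ℂ} (hΓ : Γ.PosSemidef) (hΓ' : (1 - Γ).PosSemidef) :
    (Γ - Γ * Γ).PosSemidef := by
  have h1 : (Γᴴ * (1 - Γ) * Γ).PosSemidef := hΓ'.conjTranspose_mul_mul_same Γ
  have h2 : ((1 - Γ)ᴴ * Γ * (1 - Γ)).PosSemidef := hΓ.conjTranspose_mul_mul_same (1 - Γ)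
  rw [hΓ.1.eq] at h1
  rw [hΓ'.1.eq] at h2
  have key : Γ - Γ * Γ = Γ * (1 - Γ) * Γ + (1 - Γ) * Γ * (1 - Γ) := by noncomm_ring
  rw [key]
  exact h1.add h2

/-- `0 ≤ Re Tr (A (Γ - Γ²))` for `A ⪰ 0` and `0 ≤ Γ ≤ 1`. [folklore] -/
theorem lyap_re_trace_mul_sub_sq_nonneg {A Γ : Matrix n n ℂ} (hA : A.PosSemidef) (hΓ : Γ.PosSemidef)
    (hΓ' : (1 - Γ).PosSemidef) : 0 ≤ (A * (Γ - Γ * Γ)).trace.re :=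
  Literature.LinearAlgebra.Matrix.re_trace_mul_nonneg_of_posSemidef hA (lyap_sub_sq_posSemidef hΓ hΓ')

/-! ### The negative spectral projection -/

/-- **The infimum of `Tr (X Γ)` over `0 ≤ Γ ≤ 1` is attained at the negative spectral projection**:
for Hermitian `X` of real trace zero there is `P` with `0 ≤ P ≤ 1` and
`-Re Tr (X P) = ½ Σ_i |λ_i(X)|`. [cite: BachLiebSolovej1994, Theorem 2.11] -/
theorem lyap_exists_negProj (X : Matrix n n ℂ) (hX : X.IsHermitian) (htr : X.trace.re = 0) :
    ∃ P : Matrix n n ℂ, P.PosSemidef ∧ (1 - P).PosSemidef ∧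
      -(X * P).trace.re = (∑ i, |hX.eigenvalues i|) / 2 := by
  set U : Matrix n n ℂ := (hX.eigenvectorUnitary : Matrix n n ℂ) with hUdef
  have hU : U ∈ Matrix.unitaryGroup n ℂ := hX.eigenvectorUnitary.2
  have hspec : X = U * diagonal (RCLike.ofReal ∘ hX.eigenvalues) * star U := by
    have := hX.spectral_theorem
    rw [Unitary.conjStarAlgAut_apply] at this
    exact this
  have hUU : star U * U = 1 := Matrix.mem_unitaryGroup_iff'.1 hU
  have hUU' : U * star U = 1 := Matrix.mem_unitaryGroup_iff.1 hU
  set χ : n → ℂ := fun i => if hX.eigenvalues i < 0 then 1 else 0 with hχ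
  refine ⟨U * diagonal χ * star U, ?_, ?_, ?_⟩
  · have hd : (diagonal χ).PosSemidef := by
      rw [posSemidef_diagonal_iff]
      intro i
      simp only [hχ]
      split_ifs <;> norm_num
    have := hd.mul_mul_conjTranspose_same U
    rwa [← star_eq_conjTranspose] at this
  · have hdiag : diagonal (1 - χ) = 1 - diagonal χ := by
      rw [← diagonal_one, diagonal_sub]
      rfl
    have h1 : 1 - U * diagonal χ * star U = U * diagonal (1 - χ) * star U := by
      rw [hdiag, Matrix.mul_sub, Matrix.sub_mul, Matrix.mul_one, hUU']
    rw [h1]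
    have hd : (diagonal (1 - χ)).PosSemidef := by
      rw [posSemidef_diagonal_iff]
      intro i
      simp only [hχ, Pi.sub_apply, Pi.one_apply]
      split_ifs <;> norm_num
    have := hd.mul_mul_conjTranspose_same U
    rwa [← star_eq_conjTranspose] at this
  · have hXP : X * (U * diagonal χ * star U) =
        U * (diagonal (RCLike.ofReal ∘ hX.eigenvalues) * diagonal χ) * star U := by
      conv_lhs => rw [hspec]
      simp only [Matrix.mul_assoc]
      rw [← Matrix.mul_assoc (star U) U, hUU, Matrix.one_mul]
    rw [hXP, Matrix.trace_mul_cycle, hUU, Matrix.one_mul, diagonal_mul_diagonal, trace_diagonal]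
    have hsum : ∑ i, hX.eigenvalues i = 0 := by
      have h := hX.trace_eq_sum_eigenvalues
      rw [h, Complex.re_sum] at htr
      simpa using htr
    rw [Complex.re_sum]
    have hterm : ∀ i, ((RCLike.ofReal ∘ hX.eigenvalues) i * χ i).re =
        (hX.eigenvalues i - |hX.eigenvalues i|) / 2 := by
      intro i
      have hre : ((RCLike.ofReal ∘ hX.eigenvalues) i : ℂ) = ((hX.eigenvalues i : ℝ) : ℂ) := rfl
      rw [hre]
      simp only [hχ]
      split_ifs with hlt
      · rw [abs_of_neg hlt, mul_one, Complex.ofReal_re]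
        ring
      · rw [abs_of_nonneg (not_lt.1 hlt), mul_zero, Complex.zero_re]
        ring
    simp only [hterm]
    rw [← Finset.sum_div, Finset.sum_sub_distrib, hsum]
    ring

/-! ### Bach's inequality -/

/-- **Bach's inequality** `Tr |X₀| (Γ - P)² ≤ Tr X₀ (Γ - P)` for `0 ≤ Γ ≤ 1`, where `M = |X₀|`
is given as a positive definite matrix commuting with `X₀` with `M² = X₀²`, and
`P = ½(1 - X₀ M⁻¹)` is the negative spectral projection of `X₀`. [cite: BachLiebSolovej1994, Theorem 2.11] -/
theorem lyap_bach {n : Type*} [Fintype n] [DecidableEq n] (X₀ M Γ : Matrix n n ℂ) (hX₀ : X₀.IsHermitian) (hM : M.PosDef) (hcomm : X₀ * M = M * X₀) (hsq : M * M = X₀ * X₀) (hΓ : Γ.PosSemidef) (hΓ' : (1 - Γ).PosSemidef) : (M * ((Γ - (1 / 2 : ℂ) • (1 - X₀ * M⁻¹)) * (Γ - (1 / 2 : ℂ) • (1 - X₀ * M⁻¹)))).trace.re ≤ (X₀ * (Γ - (1 / 2 : ℂ) • (1 - X₀ * M⁻¹))).trace.re := by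
  have hMdet : IsUnit M.det := (Matrix.isUnit_iff_isUnit_det M).1 hM.isUnit
  have hMM : M * M⁻¹ = 1 := Matrix.mul_nonsing_inv M hMdet
  have hMM' : M⁻¹ * M = 1 := Matrix.nonsing_inv_mul M hMdet
  have hMi : M⁻¹.IsHermitian := hM.isHermitian.inv
  have hcomm' : M⁻¹ * X₀ = X₀ * M⁻¹ := by
    calc M⁻¹ * X₀ = M⁻¹ * X₀ * (M * M⁻¹) := by rw [hMM, Matrix.mul_one]
      _ = M⁻¹ * (X₀ * M) * M⁻¹ := by simp only [Matrix.mul_assoc]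
      _ = M⁻¹ * (M * X₀) * M⁻¹ := by rw [hcomm]
      _ = X₀ * M⁻¹ := by rw [← Matrix.mul_assoc, hMM', Matrix.one_mul]
  -- `X₀² M⁻¹ = M`, `X₀ M⁻¹ X₀ = M`
  have hXXM : X₀ * X₀ * M⁻¹ = M := by rw [← hsq, Matrix.mul_assoc, hMM, Matrix.mul_one]
  have hXMX : X₀ * M⁻¹ * X₀ = M := by rw [Matrix.mul_assoc, hcomm', ← Matrix.mul_assoc, hXXM]
  have hMXM : M * X₀ * M⁻¹ = X₀ := by rw [← hcomm, Matrix.mul_assoc, hMM, Matrix.mul_one]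
  set P : Matrix n n ℂ := (1 / 2 : ℂ) • (1 - X₀ * M⁻¹) with hPdef
  set Hp : Matrix n n ℂ := (1 / 2 : ℂ) • (M + X₀) with hHpdef
  set Hm : Matrix n n ℂ := (1 / 2 : ℂ) • (M - X₀) with hHmdef
  have hMsplit : M = Hp + Hm := by
    rw [hHpdef, hHmdef, ← smul_add]
    rw [show M + X₀ + (M - X₀) = (2 : ℂ) • M by rw [two_smul]; abel, smul_smul]
    norm_num
  have hXsplit : X₀ = Hp - Hm := by
    rw [hHpdef, hHmdef, ← smul_sub]
    rw [show M + X₀ - (M - X₀) = (2 : ℂ) • X₀ by rw [two_smul]; abel, smul_smul]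
    norm_num
  -- products with `P`
  have hHpP : Hp * P = 0 := by
    rw [hHpdef, hPdef]
    simp only [smul_mul_assoc, mul_smul_comm, smul_smul]
    rw [Matrix.mul_sub, Matrix.mul_one, Matrix.add_mul M X₀ (X₀ * M⁻¹), ← Matrix.mul_assoc M X₀ M⁻¹,
      hMXM, ← Matrix.mul_assoc X₀ X₀ M⁻¹, hXXM]
    rw [show M + X₀ - (X₀ + M) = (0 : Matrix n n ℂ) by abel, smul_zero]
  have hPHp : P * Hp = 0 := by
    rw [hHpdef, hPdef]
    simp only [smul_mul_assoc, mul_smul_comm, smul_smul]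
    rw [Matrix.sub_mul, Matrix.one_mul, Matrix.mul_add (X₀ * M⁻¹) M X₀, Matrix.mul_assoc X₀ M⁻¹ M,
      hMM', Matrix.mul_one, hXMX]
    rw [show M + X₀ - (X₀ + M) = (0 : Matrix n n ℂ) by abel, smul_zero]
  have hHmP : Hm * P = Hm := by
    rw [hHmdef, hPdef]
    simp only [smul_mul_assoc, mul_smul_comm, smul_smul]
    rw [Matrix.mul_sub, Matrix.mul_one, Matrix.sub_mul M X₀ (X₀ * M⁻¹), ← Matrix.mul_assoc M X₀ M⁻¹,
      hMXM, ← Matrix.mul_assoc X₀ X₀ M⁻¹, hXXM]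
    rw [show M - X₀ - (X₀ - M) = (2 : ℂ) • (M - X₀) by rw [two_smul]; abel, smul_smul]
    norm_num
  have hPHm : P * Hm = Hm := by
    rw [hHmdef, hPdef]
    simp only [smul_mul_assoc, mul_smul_comm, smul_smul]
    rw [Matrix.sub_mul, Matrix.one_mul, Matrix.mul_sub (X₀ * M⁻¹) M X₀, Matrix.mul_assoc X₀ M⁻¹ M,
      hMM', Matrix.mul_one, hXMX]
    rw [show M - X₀ - (X₀ - M) = (2 : ℂ) • (M - X₀) by rw [two_smul]; abel, smul_smul]
    norm_num
  have hAA : X₀ * M⁻¹ * (X₀ * M⁻¹) = 1 := by rw [← Matrix.mul_assoc, hXMX, hMM]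
  have hPP : P * P = P := by
    rw [hPdef]
    simp only [smul_mul_assoc, mul_smul_comm, smul_smul]
    rw [Matrix.sub_mul, Matrix.mul_sub, Matrix.mul_sub, Matrix.one_mul, Matrix.one_mul,
      Matrix.mul_one, hAA]
    rw [show (1 : Matrix n n ℂ) - X₀ * M⁻¹ - (X₀ * M⁻¹ - 1) = (2 : ℂ) • (1 - X₀ * M⁻¹) by
      rw [two_smul]; abel, smul_smul]
    norm_num
  -- positivity of `Hp`, `Hm`: `Hm = Hmᴴ M⁻¹ Hm`, `Hp = Hpᴴ M⁻¹ Hp`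
  have hhalf : star (1 / 2 : ℂ) = 1 / 2 := by simp
  have hHmH : Hmᴴ = Hm := by
    rw [hHmdef, conjTranspose_smul, conjTranspose_sub, hM.isHermitian.eq, hX₀.eq, hhalf]
  have hHpH : Hpᴴ = Hp := by
    rw [hHpdef, conjTranspose_smul, conjTranspose_add, hM.isHermitian.eq, hX₀.eq, hhalf]
  have hHm_psd : Hm.PosSemidef := by
    have key : Hmᴴ * M⁻¹ * Hm = Hm := by
      rw [hHmH, hHmdef]
      simp only [smul_mul_assoc, mul_smul_comm, smul_smul]
      rw [Matrix.sub_mul M X₀ M⁻¹, hMM, Matrix.sub_mul, Matrix.one_mul, Matrix.mul_sub,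
        hXMX, Matrix.mul_assoc X₀ M⁻¹ M, hMM', Matrix.mul_one]
      rw [show M - X₀ - (X₀ - M) = (2 : ℂ) • (M - X₀) by rw [two_smul]; abel, smul_smul]
      norm_num
    rw [← key]
    exact hM.inv.posSemidef.conjTranspose_mul_mul_same Hm
  have hHp_psd : Hp.PosSemidef := by
    have key : Hpᴴ * M⁻¹ * Hp = Hp := by
      rw [hHpH, hHpdef]
      simp only [smul_mul_assoc, mul_smul_comm, smul_smul]
      rw [Matrix.add_mul M X₀ M⁻¹, hMM, Matrix.add_mul, Matrix.one_mul, Matrix.mul_add,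
        hXMX, Matrix.mul_assoc X₀ M⁻¹ M, hMM', Matrix.mul_one]
      rw [show M + X₀ + (X₀ + M) = (2 : ℂ) • (M + X₀) by rw [two_smul]; abel, smul_smul]
      norm_num
    rw [← key]
    exact hM.inv.posSemidef.conjTranspose_mul_mul_same Hp
  -- the two positivity facts `Tr H± (Γ - Γ²) ≥ 0`
  have hpos₁ := lyap_re_trace_mul_sub_sq_nonneg hHp_psd hΓ hΓ'
  have hpos₂ := lyap_re_trace_mul_sub_sq_nonneg hHm_psd hΓ hΓ'
  rw [Matrix.mul_sub, trace_sub, Complex.sub_re] at hpos₁ hpos₂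
  -- expand both sides in the atoms `Tr Hp Γ²`, `Tr Hp Γ`, `Tr Hm Γ²`, `Tr Hm Γ`, `Tr Hm`
  have hsq' : (Γ - P) * (Γ - P) = Γ * Γ - Γ * P - P * Γ + P := by
    rw [Matrix.sub_mul, Matrix.mul_sub, Matrix.mul_sub, hPP]
    abel
  have t1 : (Hp * (Γ * P)).trace = 0 := by
    rw [trace_mul_comm, Matrix.mul_assoc, hPHp, Matrix.mul_zero, trace_zero]
  have t2 : (Hp * (P * Γ)).trace = 0 := by
    rw [← Matrix.mul_assoc, hHpP, Matrix.zero_mul, trace_zero]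
  have t3 : (Hp * P).trace = 0 := by rw [hHpP, trace_zero]
  have t4 : (Hm * (Γ * P)).trace = (Hm * Γ).trace := by
    rw [trace_mul_comm, Matrix.mul_assoc, hPHm, trace_mul_comm]
  have t5 : (Hm * (P * Γ)).trace = (Hm * Γ).trace := by
    rw [← Matrix.mul_assoc, hHmP]
  have t6 : (Hm * P).trace = Hm.trace := by rw [hHmP]
  have hL : (M * ((Γ - P) * (Γ - P))).trace =
      (Hp * (Γ * Γ)).trace + ((Hm * (Γ * Γ)).trace - 2 * (Hm * Γ).trace + Hm.trace) := by
    rw [hsq', hMsplit, Matrix.add_mul]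
    simp only [Matrix.mul_add, Matrix.mul_sub, trace_add, trace_sub, t1, t2, t3, t4, t5, t6]
    ring
  have hR : (X₀ * (Γ - P)).trace = (Hp * Γ).trace - (Hm * Γ).trace + Hm.trace := by
    rw [hXsplit, Matrix.sub_mul]
    simp only [Matrix.mul_sub, trace_sub, t3, t6]
    ring
  rw [hL, hR]
  simp only [Complex.add_re, Complex.sub_re, Complex.mul_re, Complex.re_ofNat, Complex.im_ofNat,
    zero_mul, sub_zero]
  linarith

/-! ### The pairing block of the stability form -/

omit [DecidableEq n] in
/-- The trace of a block matrix is the sum of the traces of its diagonal blocks. [folklore] -/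
theorem lyap_trace_fromBlocks (A B C D : Matrix n n ℂ) :
    (fromBlocks A B C D).trace = A.trace + D.trace := by
  simp [Matrix.trace, Fintype.sum_sum_type]

omit [DecidableEq n] in
/-- **Block estimate**: for `E ⪰ 0` and a Hermitian block matrix `Y = [[Y₁₁, β], [βᴴ, Y₂₂]]`,
`Re Tr (βᴴ (E β + β E)) ≤ Re Tr ((E ⊕ E) Y²)` (drop `Tr (Y₁₁ E Y₁₁), Tr (Y₂₂ E Y₂₂) ≥ 0`). [folklore] -/
theorem lyap_block_trace_ge (E Y₁₁ β Y₂₂ : Matrix n n ℂ) (hE : E.PosSemidef)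
    (h₁ : Y₁₁.IsHermitian) (h₂ : Y₂₂.IsHermitian) :
    (βᴴ * (E * β + β * E)).trace.re ≤
      (fromBlocks E 0 0 E * (fromBlocks Y₁₁ β βᴴ Y₂₂ * fromBlocks Y₁₁ β βᴴ Y₂₂)).trace.re := by
  rw [fromBlocks_multiply, fromBlocks_multiply]
  simp only [Matrix.zero_mul, add_zero, zero_add]
  rw [lyap_trace_fromBlocks]
  have e1 : (E * (Y₁₁ * Y₁₁ + β * βᴴ)).trace = (Y₁₁ᴴ * E * Y₁₁).trace + (βᴴ * (E * β)).trace := by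
    rw [Matrix.mul_add, trace_add, h₁.eq, ← Matrix.mul_assoc, trace_mul_cycle E Y₁₁ Y₁₁,
      ← Matrix.mul_assoc, trace_mul_cycle E β βᴴ, Matrix.mul_assoc βᴴ E β]
  have e2 : (E * (βᴴ * β + Y₂₂ * Y₂₂)).trace = (βᴴ * (β * E)).trace + (Y₂₂ᴴ * E * Y₂₂).trace := by
    rw [Matrix.mul_add, trace_add, h₂.eq, trace_mul_comm E (βᴴ * β), Matrix.mul_assoc,
      ← Matrix.mul_assoc E Y₂₂ Y₂₂, trace_mul_cycle E Y₂₂ Y₂₂, ← Matrix.mul_assoc]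
  rw [e1, e2, Matrix.mul_add, trace_add]
  have p1 : 0 ≤ (Y₁₁ᴴ * E * Y₁₁).trace.re := by
    have := Literature.MathematicalPhysics.QuantumLattice.re_trace_nonneg_of_posSemidef
      (hE.conjTranspose_mul_mul_same Y₁₁)
    simpa only [RCLike.re_to_complex] using this
  have p2 : 0 ≤ (Y₂₂ᴴ * E * Y₂₂).trace.re := by
    have := Literature.MathematicalPhysics.QuantumLattice.re_trace_nonneg_of_posSemidef
      (hE.conjTranspose_mul_mul_same Y₂₂)
    simpa only [RCLike.re_to_complex] using this
  simp only [Complex.add_re]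
  linarith

/-- Expansion of the Lyapunov quadratic form `⟨α + γ, 𝓛_E (α + γ)⟩`. [folklore] -/
theorem lyap_quad_expand (E α γ : Matrix n n ℂ) (hE : E.IsHermitian) :
    ((α + γ)ᴴ * (E * (α + γ) + (α + γ) * E)).trace.re =
      (αᴴ * (E * α + α * E)).trace.re + 2 * (αᴴ * (E * γ + γ * E)).trace.re +
        (γᴴ * (E * γ + γ * E)).trace.re := by
  have hcross : (γᴴ * (E * α + α * E)).trace = star ((αᴴ * (E * γ + γ * E)).trace) := by
    rw [← trace_conjTranspose, conjTranspose_mul, conjTranspose_add, conjTranspose_mul,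
      conjTranspose_mul, conjTranspose_conjTranspose, hE.eq, Matrix.add_mul, Matrix.mul_add,
      trace_add, trace_add, Matrix.mul_assoc γᴴ E α, Matrix.mul_assoc E γᴴ α,
      trace_mul_comm E (γᴴ * α), Matrix.mul_assoc γᴴ α E]
  have hexp : (α + γ)ᴴ * (E * (α + γ) + (α + γ) * E) =
      αᴴ * (E * α + α * E) + αᴴ * (E * γ + γ * E) + γᴴ * (E * α + α * E) +
        γᴴ * (E * γ + γ * E) := by
    rw [conjTranspose_add]
    noncomm_ring
  rw [hexp, trace_add, trace_add, trace_add, hcross]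
  simp only [Complex.add_re, Complex.star_def, Complex.conj_re]
  ring

/-! ### The pairing perturbation -/

omit [DecidableEq n] in
/-- The pairing perturbation contributes `2 Re Tr (Bᴴ α)` to `Tr ([[0, B], [Bᴴ, 0]] Γ)`, `α` the
upper-right block of the Hermitian `Γ`. [folklore] -/
theorem lyap_re_trace_offDiag_mul (B : Matrix n n ℂ) (Γ : Matrix (n ⊕ n) (n ⊕ n) ℂ)
    (hΓ : Γ.IsHermitian) :
    (fromBlocks 0 B Bᴴ 0 * Γ).trace.re = 2 * (Bᴴ * Γ.toBlocks₁₂).trace.re := by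
  conv_lhs => rw [← fromBlocks_toBlocks Γ]
  rw [fromBlocks_multiply]
  simp only [Matrix.zero_mul, zero_add, add_zero]
  rw [lyap_trace_fromBlocks]
  have h21 : Γ.toBlocks₂₁ = (Γ.toBlocks₁₂)ᴴ := by
    ext i j
    simp only [toBlocks₂₁, toBlocks₁₂, conjTranspose_apply, of_apply]
    exact (hΓ.apply _ _).symm
  rw [h21]
  have : (B * (Γ.toBlocks₁₂)ᴴ).trace = star ((Bᴴ * Γ.toBlocks₁₂).trace) := by
    rw [← trace_conjTranspose, conjTranspose_mul, conjTranspose_conjTranspose, trace_mul_comm]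
  rw [this]
  simp only [Complex.add_re, Complex.star_def, Complex.conj_re]
  ring

end BirBdG

end Summit.HubbardSuperconductivity.HubbardSuperconductivity.Theorems

end
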